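import Literature.AnabelianGeometry.EtaleTheta.ArithThetaTowerDivisorMonoidsLaws
import Literature.AnabelianGeometry.EtaleTheta.ArithThetaTowerDivisorsGeom
import HarnessLib

/-!
# [EtTh] Def. 3.3 (iii) for the ARITHMETIC theta tower (GAP A, item GA-02), THE CARRIER: the chair's ruled decl
# `ArithThetaTower.divisorMonoids d T : DivisorMonoids T.Dv` — GENUINE constants × GA-10's decreed theta envelope — with `constDivIncl`,
# the residual `SpecialFibreCoupling`, Prop. 3.4 (ii) at the carrier, and the theta section `θ ∈ B₀(Ÿ_T)`, `div₀ θ = ι₂([cusps] − [D_1])`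

S. Mochizuki, *The étale theta function …*, Publ. RIMS **45** (2009) [MochizukiEtTh2009], Prop. 1.4 (i) PDF p.21 («the zeroes of `Θ̈` on `Ÿ`
are precisely the cusps of `Ÿ`; each zero has multiplicity 1. The divisor of poles of `Θ̈` on `Ÿ` is precisely the divisor `D_1`»; the formula
`Θ̈(Ü) = q^{−1/8} Σ (−1)^n q^{(n+½)²/2} Ü^{2n+1}` has the TWO zeros `Ü = ±1` on the component labelled `0`), Rmk. 1.3.1 (`D_1` does not descend),
Def. 3.3 (iii) p.73 («`Φ₀`, `B₀`, `B₀ → Φ₀^gp`, `F₀`»), Prop. 3.4 (ii) p.74 [cite: MochizukiEtTh2009, Def 3.3 p.73]; [IUTchI] Ex. 3.2 (i)(ii) p.70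
[claim: Mochizuki2012, status: disputed — nothing of the series is asserted]; [FrdII] Ex. 1.1 (i) p.7.

abc-iut cell, GAP A = G-L5-EX32I-1 (the UNDISPUTED construction around [IUTchIII] Cor. 3.12), item **GA-02** — the chair's EXACT ruled decl
(`plan/L5/GAP-A-SIGNATURES.md` v1 e3ccddf9b87597cf §0/§2; RULINGS #317 (2) / #319 / #321 / #322 (c2′)(c3′) / #330–#339; #334 COUNTERSIGN of
this seat's signature with the ⊕-type conditions (a)(b)(c); pen C-R257/C-R258 «ONE RECIPE achieved at the ruled decl»):
**`ArithThetaTower.divisorMonoids (d : GaloisValDatum.{0} p) (T : BadLocalGroupDatum d.Gal P) : DivisorMonoids.{0,0,0} T.Dv`**, binders and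
result type VERBATIM, DEFINED as this seat's ENGINE `divisorMonoidsOf d T` (`ArithThetaTowerDivisorMonoids.lean`, ★ p667325: GENUINE constants
`(Ω^{aug U})^×` with their genuine valuations at EVERY `U ∈ 𝒟_v̲` through `T.proj` — NOT `rebase` — times the geometric Def. 3.3 (iii) data) AT
GA-10's COUNTERSIGNED GENERIC THETA ENVELOPE (RULINGS #338 (B)): `Envelope.model (P ⧸ T.Y)` (`ArithThetaTowerEnvelopeModel.lean`, ★ p668511:
components the fibre `P ⧸ T.Y` of `Ÿ_T → X̲̲_v̲`, cusps `(P ⧸ T.Y) × Bool` — print's TWO zeros `Ü = ±1` of `Θ̈` on each component —, functions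
the free group on the theta translates, `const = 𝒪^▷ = 1`) with its deck action `Envelope.action` (`ArithThetaTowerDivisorsGeom.lean`)
instantiated at **`Γ := P`, `C := P ⧸ T.Y`** (Mathlib's left action; NO new instance): this IS the pull-back along `P ↠ Γ_Θ T` of the
`Γ_Θ T`-action, since `N_Θ T = core(Π_Ÿ)` acts trivially on `P ⧸ T.Y` (`ArithThetaTower.smul_fib_eq_of_mem_NΘ`, ★ p668980) — «`Φ₀^geom(rebase T U)`».
ONE RECIPE: GA-10's `divisorsGeom P (P ⧸ T.Y)` IS this file's geometric factor (`divisorsGeom_eq`, their `rfl`); this seat's T-indexed twin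
`envelopeModel T` (★ p668980; ONE cusp per component = the μ₂-collapsed chain `Y`, E-GA02-1) is NOT the recipe of record.

CONTENTS: §1 the ruled decl + `rfl` shapes (`Φ₀(U) = ord(𝒪^▷_{Ω^{aug U}}) × Div⁺(envelope)^U`, `B₀(U) = (Ω^{aug U})^× × ⟨Θ̈_c⟩^U`, `F₀(U) =
(Ω^{aug U})^× × 1`), `hBinj`; §2 RULINGS #334 (2): (b) **`constDivIncl d T U`** + `constDivIncl_natural` + `div₀_const'`, (c) **`SpecialFibreCoupling d
T : Prop`** (statement only), and Prop. 3.4 (ii) clause 1 **PROVED at the carrier** (`divisorMonoids_ker_div₀_le_F₀`); §3 the THETA SECTION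
**`thetaB₀ d T ∈ B₀(Ÿ_T)`** at the slot's object `Ÿ_T = T.ydd` — (`1 ∈ K_v̲^×`, `x·Π_Ÿ ↦ Θ̈_x`) — with `thetaZerosGeom` (CUSPIDAL, `≠ 1`),
`thetaPolesGeom` (NON-CUSPIDAL, `≠ 1`), **`divZeroHom_thetaGeom : div₀^geom θ = [cusps]/[D_1]`**, **`div₀_thetaB₀ : div₀ θ = ι₁(1)·ι₂([cusps]/[D_1])`**.

⊕-DECOUPLED (RULINGS #334 (2)(a), verbatim): «the print identification div(ϖ_U) = Σ special-fibre components is NOT imposed at the decreed avatar;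
constants' divisors = the genuine value monoid `OrdInt` ([FrdII] Ex 1.1 (i)); geometric divisors = the envelope; coupling deferred with FOUNDATIONS 13».
CARRIER LABEL OF RECORD (RULINGS #322 (c3′), verbatim): «carrier: genuine-by-[EtTh]-recipe on the T-lattice (Ÿ_T, Ÿ_T × V, X̲̲_v̲ × V) + constants
everywhere; off-lattice Φ via `rebase`/pullback; [EtTh] Def 3.3 Φ at general U and print's Ÿ̈/μ_N Kummer levels = FOUNDATIONS 13/14, not claimed».
GUARD (#322): «for a `T` that is not a finite level of the theta tower the carrier is print's recipe TRANSPORTED by (n_T, e(V|K_v̲))» — components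
⊔ cusps transported by the fibre `P ⧸ T.Y` (`n_T = [P : T.Y]` of them), constants' multiplicities by the genuine value monoids `ord(𝒪^▷_{Ω^{aug U}})`
(`e(V|K_v̲)` carried by the field inclusions `fixedHom`).  THETA CLAUSE (crit-A L1 + E-GA02-1): of [EtTh] Prop. 1.4 only the CUSP HALF (i) is
print-transported («zeros of order 1 exactly at the cusps», to the cusp set `(P ⧸ T.Y) × Bool`); «div Θ̈ = [cusps] − [D_1]» with `D_1 := [F_{1·Π_Ÿ}]`
is a DECREE of the finite avatar (one decreed vertical pole of multiplicity one so that the translates `Θ̈_x` are permuted faithfully by the deck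
action) — NOT Prop. 1.4 (ii)'s quadratic pole profile `q^{−j²/2}` along `D_j`, which is non-periodic and descends to no finite covering (Rmk. 1.3.1;
FOUNDATIONS 13).  No `Prop`-valued fact beyond the chair-ordered residual STATEMENT `SpecialFibreCoupling`; no instance, no notation, no sorry.
HONEST FRAMING: a construction over typed interfaces joining GENUINE constants to a DECREED finite avatar; not asserted to be the tempered Frobenioid
of a Tate curve beyond the labels above; no side taken on [IUTchIII] Cor. 3.12; typed ≠ inhabited ≠ proved-in-print; count-neutral; NO abc claim.
-/

noncomputable section

namespace Literature.AnabelianGeometry.EtaleTheta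

open CategoryTheory Opposite Function Literature.AlgebraicGeometry.Frobenioids
  Literature.AlgebraicGeometry.Frobenioids.PadicFrd Literature.AnabelianGeometry.SemiGraphs Literature.IUT.HodgeTheaters
  LogDivisorModel LogDivisorModel.GaloisAction

namespace ArithThetaTower

variable {p : ℕ} [Fact p.Prime] (d : GaloisValDatum.{0} p) {P : Type} [Group P] [TopologicalSpace P]
  (T : BadLocalGroupDatum d.Gal P)

/-! ## §1 THE RULED DECL `ArithThetaTower.divisorMonoids d T` -/

/-- The fibre `P ⧸ Π_Ÿ` of `Ÿ_T → X̲̲_v̲` = the component set of the decreed envelope (= `Fib d T` of ★ p668980, same type).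
[cite: Mochizuki2012, I Ex 3.2 (ii) p.70] -/
abbrev Cpt : Type := P ⧸ (T.Y : Subgroup P)

/-- **The deck action of `Π` on GA-10's theta envelope of the fibre** — `Envelope.action` at `Γ := Π`, `C := Π ⧸ Π_Ÿ` (left translation);
it factors through `Γ_Θ T` (`smul_fib_eq_of_mem_NΘ`), i.e. is the pull-back along `rebase T`. [cite: MochizukiEtTh2009, Def 3.3 p.73] -/
abbrev deckAction : (Envelope.model (Cpt d T)).GaloisAction P := Envelope.action (Cpt d T) P

/-- **[EtTh] Def. 3.3 (iii) data of the ARITHMETIC THETA TOWER over the kit's own base `𝒟_v̲ = CosetCat Π`** (GAP A item GA-02; the chair's ruled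
shape, binders and result type verbatim): the engine `divisorMonoidsOf d T` — GENUINE CONSTANTS `(Ω^{aug U})^×` with their genuine valuations at
EVERY `U` through `T.proj` — at GA-10's decreed theta envelope `Envelope.model (Π ⧸ Π_Ÿ)` with the deck action of `Π` (pulled back along
`rebase T`).  `Φ₀(U) = ord(𝒪^▷_{Ω^{aug U}}) × Div⁺(envelope)^U` («`Φ₀^geom(rebase U) + ord(Ω^{aug U})·F`», `+` READ AS DIRECT SUM — RULINGS #334 (2)),
`B₀(U) = (Ω^{aug U})^× × ⟨Θ̈_c⟩^U` («`(Ω^{aug U})^× · B₀^geom(rebase U)`»), `F₀(U) = (Ω^{aug U})^× × 1`.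
⊕-DECOUPLED: the print identification div(ϖ_U) = Σ special-fibre components is NOT imposed at the decreed avatar; constants' divisors = the
genuine value monoid `OrdInt` ([FrdII] Ex 1.1 (i)); geometric divisors = the envelope; coupling deferred with FOUNDATIONS 13 (residual:
`SpecialFibreCoupling`).  CARRIER (RULINGS #322 (c3′)): «genuine-by-[EtTh]-recipe on the T-lattice (Ÿ_T, Ÿ_T × V, X̲̲_v̲ × V) + constants everywhere;
off-lattice Φ via `rebase`/pullback; [EtTh] Def 3.3 Φ at general U and print's Ÿ̈/μ_N Kummer levels = FOUNDATIONS 13/14, not claimed»; GUARD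
(#322): «for a `T` that is not a finite level of the theta tower the carrier is print's recipe TRANSPORTED by (n_T, e(V|K_v̲))».
[cite: MochizukiEtTh2009, Def 3.3 p.73] -/
def divisorMonoids : DivisorMonoids.{0, 0, 0} T.Dv := divisorMonoidsOf d T (deckAction d T) (Envelope.cuspLaws (Cpt d T))

/-- The ruled decl IS the engine at GA-10's envelope with the deck action of `Π` (by definition). [cite: MochizukiEtTh2009, Def 3.3 p.73] -/
theorem divisorMonoids_eq : divisorMonoids d T = divisorMonoidsOf d T (deckAction d T) (Envelope.cuspLaws (Cpt d T)) := rfl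

/-- ONE RECIPE: the geometric factor of the ruled decl IS GA-10's ruled `divisorsGeom Π (Π ⧸ Π_Ÿ)` read through this seat's engine route
(`geomDivisorMonoids`). [cite: MochizukiEtTh2009, Def 3.3 p.73] -/
theorem divisorMonoids_eq_prod :
    divisorMonoids d T = (constDivisorMonoids d T).prod (geomDivisorMonoids (deckAction d T) (Envelope.cuspLaws (Cpt d T))) := rfl

/-- ONE RECIPE, by name: the geometric factor IS GA-10's ruled `divisorsGeom Π (Π ⧸ Π_Ÿ)` (★ p670709; their `divisorsGeom_eq`).
[cite: MochizukiEtTh2009, Def 3.3 p.73] -/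
theorem divisorMonoids_eq_prod_divisorsGeom :
    divisorMonoids d T = (constDivisorMonoids d T).prod (divisorsGeom P (Cpt d T)) := rfl

/-- **`Φ₀(U) = ord(𝒪^▷_{Ω^{aug U}}) × Hom_Π(Π/U, Div⁺(envelope))`** (definitionally; GA-03's `hpf` is stated against this shape).
[cite: MochizukiEtTh2009, Def 3.3 p.73] -/
theorem divisorMonoids_Φ₀_obj (U : T.Dvᵒᵖ) :
    (divisorMonoids d T).Φ₀.obj U =
      CommMonCat.of (OrdInt (constFld d T U.unop).K × (deckAction d T).phiZero ((cosetGSetFunctor P).obj U.unop)) := rfl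

/-- **`B₀(U) = (Ω^{aug U})^× × Hom_Π(Π/U, ⟨Θ̈_c⟩)`** (definitionally). [cite: MochizukiEtTh2009, Def 3.3 p.73] -/
theorem divisorMonoids_B₀_obj (U : T.Dvᵒᵖ) :
    (divisorMonoids d T).B₀.obj U =
      CommMonCat.of (((constFld d T U.unop).K)ˣ × (deckAction d T).bZero ((cosetGSetFunctor P).obj U.unop)) := rfl

/-- `F₀(U) = (Ω^{aug U})^× × (constant functions of the envelope)^U` — and the envelope has NO constants, so the genuine constants ARE `F₀`.
[cite: MochizukiEtTh2009, Def 3.3 p.73] -/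
theorem divisorMonoids_F₀ (U : T.Dvᵒᵖ) :
    (divisorMonoids d T).F₀ U =
      (⊤ : Submonoid ((constFld d T U.unop).K)ˣ).prod ((deckAction d T).fZero ((cosetGSetFunctor P).obj U.unop)) := rfl

/-- The transitions of `B₀` of the ruled data are injective (the Def. 3.6 (i) binder `hBinj`). [cite: MochizukiEtTh2009, Def 3.6 p.76] -/
theorem divisorMonoids_B₀_map_injective {U V : T.Dvᵒᵖ} (f : U ⟶ V) : Injective ((divisorMonoids d T).B₀.map f).hom :=
  divisorMonoidsOf_B₀_map_injective d T _ _ f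

/-! ## §2 RULINGS #334 (2): `constDivIncl` BY NAME, the residual `SpecialFibreCoupling`, and Prop. 3.4 (ii) AT THE CARRIER -/

/-- **`constDivIncl U : ord(𝒪^▷_{Ω^{aug U}}) →* Φ₀(U)`** — the (ii)-hull inclusion of the constants' divisors of the ruled data, BY NAME
(RULINGS #334 (2)(b); `= MonoidHom.inl`, the constants are the FIRST factor). [cite: MochizukiEtTh2009, Def 3.3 p.73] -/
def constDivIncl (U : T.Dvᵒᵖ) :
    OrdInt (constFld d T U.unop).K →* (OrdInt (constFld d T U.unop).K × (deckAction d T).phiZero ((cosetGSetFunctor P).obj U.unop)) :=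
  constDivInclOf d T (deckAction d T) U

/-- `constDivIncl` lands in `Φ₀(U)` of the ruled data: `x ↦ (x, 1)`. [cite: MochizukiEtTh2009, Def 3.3 p.73] -/
theorem constDivIncl_mem (U : T.Dvᵒᵖ) (x : OrdInt (constFld d T U.unop).K) :
    (constDivIncl d T U x : (divisorMonoids d T).Φ₀.obj U) = (x, 1) := rfl

/-- `constDivIncl` is injective. [cite: MochizukiEtTh2009, Def 3.3 p.73] -/
theorem constDivIncl_injective (U : T.Dvᵒᵖ) : Injective (constDivIncl d T U) := constDivInclOf_injective d T _ U

/-- **Naturality of `constDivIncl`** along every `f : U → V` of `𝒟_v̲`: `Φ₀.map f ∘ constDivIncl_U = constDivIncl_V ∘ ord(fixedHom f)`.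
[cite: MochizukiEtTh2009, Def 3.3 p.73] -/
theorem constDivIncl_natural {U V : T.Dvᵒᵖ} (f : U ⟶ V) (x : OrdInt (constFld d T U.unop).K) :
    ((divisorMonoids d T).Φ₀.map f).hom (constDivIncl d T U x) =
      constDivIncl d T V
        (ordIntMapOfHom (d.fieldFunctor.map (T.proj.map f.unop)).alg (d.fieldFunctor.map (T.proj.map f.unop)).isValHom x) :=
  constDivInclOf_natural d T _ _ f x

/-- **The divisor of a genuine constant of the ruled data is its valuation through `constDivIncl`.** [cite: MochizukiEtTh2009, Def 3.3 p.73] -/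
theorem div₀_const' (U : T.Dvᵒᵖ) (c : ((constFld d T U.unop).K)ˣ) :
    (divisorMonoids d T).div₀ U ((c, 1) : ((constFld d T U.unop).K)ˣ × (deckAction d T).bZero ((cosetGSetFunctor P).obj U.unop)) =
      gpMap (constDivIncl d T U) (divUnits (constFld d T U.unop).K c) :=
  div₀_const d T _ _ U c

/-- **`SpecialFibreCoupling d T` — the RECORDED RESIDUAL of the ⊕-decoupled ruled data** (RULINGS #334 (2)(c); STATEMENT ONLY — see
`SpecialFibreCouplingOf`: the data identifying `[ϖ_U]` with `F_U^{1/e_U}` in `Φ₀^geom(U)^pf`, naturally in `U`, from which print's coupled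
`Φ₀` is the amalgamated sum). [cite: MochizukiEtTh2009, Def 3.3 p.73] -/
def SpecialFibreCoupling : Prop := SpecialFibreCouplingOf d T (deckAction d T)

/-- The envelope has no integral constants (`𝒪^▷ = 1`, GA-10's `Envelope.model`). [cite: MochizukiEtTh2009, Prop 3.2 p.70] -/
theorem envelope_intConst_eq_bot : (Envelope.model (Cpt d T)).intConst = ⊥ := rfl

/-- **Prop. 3.4 (ii), first clause, PROVED AT THE CARRIER** («`Ker(B₀(Y) → Φ₀^gp(Y)) ⊆ F₀(Y)`»: an element of `B₀(U)` with trivial divisor is a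
genuine constant times the trivial theta monomial). [cite: MochizukiEtTh2009, Prop 3.4 p.74] -/
theorem divisorMonoids_ker_div₀_le_F₀ (U : T.Dvᵒᵖ) (b : (divisorMonoids d T).B₀.obj U) (hb : (divisorMonoids d T).div₀ U b = 1) :
    b ∈ (divisorMonoids d T).F₀ U :=
  divisorMonoidsOf_ker_div₀_le_F₀_of_intConst_eq_bot d T _ _ (envelope_intConst_eq_bot d T) U b hb

/-- **`F₀(U)` is inverse-closed at the engine** (the `hFinv`-shape binder of the downstream realification, for EVERY geometric input): the
genuine constants form a group and the envelope's constant functions are closed under inverses. [cite: MochizukiEtTh2009, Prop 3.4 p.74] -/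
theorem divisorMonoidsOf_exists_inv_F₀ {Z : LogDivisorModel.{0}} (A : Z.GaloisAction P) (hZ : Z.CuspLaws) (U : T.Dvᵒᵖ)
    (b : ((constFld d T U.unop).K)ˣ × A.bZero ((cosetGSetFunctor P).obj U.unop)) (hb : b ∈ (divisorMonoidsOf d T A hZ).F₀ U) :
    ∃ b' : ((constFld d T U.unop).K)ˣ × A.bZero ((cosetGSetFunctor P).obj U.unop), b' ∈ (divisorMonoidsOf d T A hZ).F₀ U ∧ b' * b = 1 :=
  ⟨(b.1⁻¹, b.2⁻¹), ⟨trivial, fun s => Z.const.inv_mem (hb.2 s)⟩, Prod.ext (inv_mul_cancel b.1) (inv_mul_cancel b.2)⟩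

/-- **`F₀(U)` of the ruled data is inverse-closed** (`hFinv` AT THE CARRIER). [cite: MochizukiEtTh2009, Prop 3.4 p.74] -/
theorem divisorMonoids_exists_inv_F₀ (U : T.Dvᵒᵖ)
    (b : ((constFld d T U.unop).K)ˣ × (deckAction d T).bZero ((cosetGSetFunctor P).obj U.unop)) (hb : b ∈ (divisorMonoids d T).F₀ U) :
    ∃ b' : ((constFld d T U.unop).K)ˣ × (deckAction d T).bZero ((cosetGSetFunctor P).obj U.unop), b' ∈ (divisorMonoids d T).F₀ U ∧ b' * b = 1 :=
  divisorMonoidsOf_exists_inv_F₀ d T _ _ U b hb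

/-- The envelope has NO constant functions: `F₀^geom(U) = 1`, so **`F₀(U)` of the ruled data is EXACTLY the genuine constants `(Ω^{aug U})^× × 1`**.
[cite: MochizukiEtTh2009, Prop 3.4 p.74] -/
theorem mem_divisorMonoids_F₀_iff (U : T.Dvᵒᵖ)
    (b : ((constFld d T U.unop).K)ˣ × (deckAction d T).bZero ((cosetGSetFunctor P).obj U.unop)) :
    b ∈ (divisorMonoids d T).F₀ U ↔ b.2 = 1 := by
  constructor
  · rintro ⟨-, h⟩
    exact Subtype.ext (funext fun s => Subgroup.mem_bot.mp (h s))
  · intro h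
    refine ⟨trivial, fun s => ?_⟩
    rw [h]
    exact Subgroup.one_mem _

/-! ## §3 The theta section `θ ∈ B₀(Ÿ_T)` and its divisor `[cusps] − [D_1]` -/

/-- The `Π`-set `Π/Π_Ÿ` = the value of `cosetGSetFunctor` at the slot's object `Ÿ_T = T.ydd` (definitionally). [cite: Mochizuki2012, I Ex 3.2 (ii) p.70] -/
abbrev cptGSet : Action (Type 0) P := Action.ofMulAction P (Cpt d T)

/-- `cosetGSetFunctor` at `Ÿ_T` IS the fibre `Π`-set (by definition). [cite: Mochizuki2012, I Ex 3.2 (ii) p.70] -/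
theorem cosetGSetFunctor_obj_ydd' : (cosetGSetFunctor P).obj T.ydd = cptGSet d T := rfl

/-- **The theta section over `Ÿ_T`** in the geometric factor: the `Π`-equivariant family `x·Π_Ÿ ↦ Θ̈_x` of GA-10's theta translates
(`Envelope.actFn_theta`: `g·Θ̈_x = Θ̈_{g·x}`), an element of `B₀^geom(Ÿ_T) = Hom_Π(Π/Π_Ÿ, ⟨Θ̈⟩)`. [cite: MochizukiEtTh2009, Prop 1.4 p.21] -/
def thetaGeom' : (deckAction d T).bZero (cptGSet d T) :=
  ⟨fun x : Cpt d T => Envelope.theta x, fun x => Envelope.theta_mem_logMero (show Cpt d T from x), fun g x => by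
    change Envelope.theta (g • show Cpt d T from x) = (Envelope.action (Cpt d T) P).actFn g (Envelope.theta x)
    exact (Envelope.actFn_theta (C := Cpt d T) (Γ := P) g (show Cpt d T from x)).symm⟩

/-- The zero-divisor family `x ↦ [all cusps]` in `Φ₀^geom(Ÿ_T)` (CUSPIDAL, `Π`-invariant). [cite: MochizukiEtTh2009, Prop 1.4 p.21] -/
def thetaZerosGeom' : (deckAction d T).phiZero (cptGSet d T) :=
  ⟨fun _ : Cpt d T => (Envelope.thetaZeros (Cpt d T) : (Envelope.model (Cpt d T)).DIV), fun _ => ⟨trivial, (Envelope.thetaZeros (Cpt d T)).2⟩,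
    fun g _ => (Envelope.actDIV_thetaZeros (C := Cpt d T) (Γ := P) g).symm⟩

/-- The polar-divisor family `x·Π_Ÿ ↦ [F_x]` in `Φ₀^geom(Ÿ_T)` (NON-CUSPIDAL; `D_1` and its translates). [cite: MochizukiEtTh2009, Prop 1.4 p.21] -/
def thetaPolesGeom' : (deckAction d T).phiZero (cptGSet d T) :=
  ⟨fun x : Cpt d T => (Envelope.thetaPoles x : (Envelope.model (Cpt d T)).DIV),
    fun x => ⟨trivial, (Envelope.thetaPoles (show Cpt d T from x)).2⟩, fun g x => by
    change (Envelope.thetaPoles (g • show Cpt d T from x) : (Envelope.model (Cpt d T)).DIV) = _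
    exact (Envelope.actDIV_thetaPoles (C := Cpt d T) (Γ := P) g (show Cpt d T from x)).symm⟩

/-- **`div₀^geom θ = [cusps]/[D_1]`** in `Φ₀^geom(Ÿ_T)^gp` (abc-iut-w6-d058's `divZeroHom_eq_div_iff` + GA-10's `divisor_theta`).
[cite: MochizukiEtTh2009, Prop 1.4 p.21] -/
theorem divZeroHom_thetaGeom' :
    (deckAction d T).divZeroHom (cptGSet d T) (thetaGeom' d T) =
      Algebra.GrothendieckGroup.of (thetaZerosGeom' d T) / Algebra.GrothendieckGroup.of (thetaPolesGeom' d T) :=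
  ((deckAction d T).divZeroHom_eq_div_iff (cptGSet d T) _ _ _).2 fun x' => by
    let x : Cpt d T := x'
    change (Envelope.model (Cpt d T)).divisor ⟨Envelope.theta x, Envelope.theta_mem_logMero x⟩ *
        (Envelope.thetaPoles x : (Envelope.model (Cpt d T)).DIV) = (Envelope.thetaZeros (Cpt d T) : (Envelope.model (Cpt d T)).DIV)
    rw [Envelope.divisor_theta, div_mul_cancel]

/-- The zero family is CUSPIDAL. [cite: MochizukiEtTh2009, Prop 1.4 p.21] -/
theorem thetaZerosGeom'_mem_cspZero : thetaZerosGeom' d T ∈ (deckAction d T).cspZero (cptGSet d T) :=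
  fun _ => Envelope.thetaZeros_mem_cuspidal

/-- The polar family is NON-CUSPIDAL. [cite: MochizukiEtTh2009, Prop 1.4 p.21] -/
theorem thetaPolesGeom'_mem_ncspZero : thetaPolesGeom' d T ∈ (deckAction d T).ncspZero (cptGSet d T) :=
  fun x => (Envelope.thetaPoles_mem_nonCuspidal (show Cpt d T from x)).1

/-- The zero family is non-trivial (the fibre is non-empty: it contains `1·Π_Ÿ`). [cite: MochizukiEtTh2009, Prop 1.4 p.21] -/
theorem thetaZerosGeom'_ne_one : thetaZerosGeom' d T ≠ 1 := fun h => by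
  haveI : Nonempty (Cpt d T) := ⟨((1 : P) : Cpt d T)⟩
  have e : (Envelope.thetaZeros (Cpt d T) : (Envelope.model (Cpt d T)).DIV) =
      ((1 : (Envelope.model (Cpt d T)).DIVplus) : (Envelope.model (Cpt d T)).DIV) :=
    congrArg (fun φ : (deckAction d T).phiZero (cptGSet d T) => φ.1 ((1 : P) : Cpt d T)) h
  exact Envelope.thetaZeros_ne_one (C := Cpt d T) (Subtype.ext e)

/-- The polar family is non-trivial. [cite: MochizukiEtTh2009, Prop 1.4 p.21] -/
theorem thetaPolesGeom'_ne_one : thetaPolesGeom' d T ≠ 1 := fun h => by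
  have e : (Envelope.thetaPoles ((1 : P) : Cpt d T) : (Envelope.model (Cpt d T)).DIV) =
      ((1 : (Envelope.model (Cpt d T)).DIVplus) : (Envelope.model (Cpt d T)).DIV) :=
    congrArg (fun φ : (deckAction d T).phiZero (cptGSet d T) => φ.1 ((1 : P) : Cpt d T)) h
  exact Envelope.thetaPoles_ne_one ((1 : P) : Cpt d T) (Subtype.ext e)

/-- **THE THETA SECTION `θ ∈ B₀(Ÿ_T)` of the ruled data** at the slot's object `Ÿ_T = T.ydd`: genuine-constant component
`1 ∈ (Ω^{aug Π_Ÿ})^× = K_v̲^×`, geometric component the family of theta translates. [cite: MochizukiEtTh2009, Prop 1.4 p.21] -/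
def thetaB₀ : (divisorMonoids d T).B₀.obj (op T.ydd) := ((1 : ((constFld d T T.ydd).K)ˣ), thetaGeom' d T)

/-- **`div₀ θ = ι₁(1) · ι₂([cusps]/[D_1])`** in `Φ₀(Ÿ_T)^gp = (ord(𝒪^▷_{K_v̲}) × Φ₀^geom(Ÿ_T))^gp`: the constant part of the divisor of the theta
section is TRIVIAL, the geometric part is zero divisor THE CUSPS (cuspidal) over the polar divisor `D_1` and its translates (non-cuspidal) — the
shape of a Def. 4.1 (i) fraction-pair / of S0's `CarrierSpec.theta`. [cite: MochizukiEtTh2009, Prop 1.4 p.21] -/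
theorem div₀_thetaB₀ :
    (divisorMonoids d T).div₀ (op T.ydd) (thetaB₀ d T) =
      gpMap (MonoidHom.inl _ _) (1 : Algebra.GrothendieckGroup (OrdInt (constFld d T T.ydd).K)) *
        gpMap (MonoidHom.inr _ _)
          (Algebra.GrothendieckGroup.of (thetaZerosGeom' d T) / Algebra.GrothendieckGroup.of (thetaPolesGeom' d T)) := by
  rw [← divZeroHom_thetaGeom']
  refine (divisorMonoidsOf_div₀_apply d T (deckAction d T) (Envelope.cuspLaws (Cpt d T)) (op T.ydd) (thetaB₀ d T)).trans ?_
  congr 2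
  exact map_one (divUnits (constFld d T T.ydd).K)

end ArithThetaTower

end Literature.AnabelianGeometry.EtaleTheta

end
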